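import Mathlib.LinearAlgebra.Eigenspace.Minpoly
import Literature.AlgebraicGeometry.HodgeTheory.WeilClassesCyclicPrymDimension
import HarnessLib

/-!
# Multiplicity of `ζ₇` from traces, and its invariance under an equivariant quotient by `im Φ₇`

Helper file for line `isotypic-unimodular-saturation`, stub `stub_heckePrymWeilPlane`
(`--supports stmt-HodgeConjecture-1261`): the LINEAR ALGEBRA of the Chevalley–Weil count behind the
first conjunct `dim P' = 12` (pattern: `HodgeTheory.WeilClassesCyclicPrymDimension`, §1, the `ℤ/6`
twin).  For an endomorphism `T` of a finite-dimensional complex vector space with `T⁷ = 1` and a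
seventh root of unity `c` (`c⁷ = 1`):

* `isProj_eigenspace_of_pow_seven` — `P_c = 7⁻¹ Σ_k c^{-k} Tᵏ` (the primitive idempotent of
  `ℂ[ℤ/7]` at `c`) is a projection onto the `c`-eigenspace of `T`;
* `seven_mul_finrank_eigenspace` — **`7 · dim Eig(T, c) = Σ_{k<7} c^{-k} tr Tᵏ`** (character
  orthogonality, as the trace of `P_c`);
* `finrank_eigenspace_eq_twelve` — if `dim V = 86` and `tr Tʲ = 2` for `j = 1, …, 6` (the traces of a
  fixed-point-free automorphism of order `7` of a genus-`43` curve on `H¹`: Lefschetz) and `c` is a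
  PRIMITIVE seventh root (`Φ₇(c) = 0`), then `dim Eig(T, c) = (86 - 2)/7 = 12`;
* `finrank_eigenspace_eq_of_surjective` — **the multiplicity of a primitive `c` is unchanged under an
  equivariant surjection `f : V ↠ W` whose kernel contains `im Φ₇(T)` and with
  `dim W = dim ker Φ₇(T)`** (then `ker f = im Φ₇(T)` meets `Eig(T, c)` in `0` because
  `Φ₇(T)² = 7 Φ₇(T)` while `Φ₇(c) = 0`, and `Eig(T', c) = f(Eig(T, c))` by the projector): the shape of
  `ι^* : H¹(J) ↠ H¹(B)` for the Prym `B = (ker Φ₇(σ_*))⁰ ⊂ J` (`HodgeTheory.AbelianVarietyHOneExactness`).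

No definitions; no named facts; everything PROVED.
-/

noncomputable section

set_option linter.dupNamespace false

open Polynomial Module

namespace Summit.HodgeConjecture.HodgeConjecture.Theorems.WeilTwelvefoldsSqrtMinus7.IsotypicUnimodularSaturation

section LinearAlgebra

variable {V W : Type*} [AddCommGroup V] [Module ℂ V] [AddCommGroup W] [Module ℂ W]

/-- `(X - c) · (1 + c⁶X + c⁵X² + c⁴X³ + c³X⁴ + c²X⁵ + cX⁶) = c (X⁷ - 1)` for `c⁷ = 1`. [folklore] -/
theorem X_sub_C_mul_projPoly {c : ℂ} (h7 : c ^ 7 = 1) :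
    ((X : ℂ[X]) - C c) * (1 + C c ^ 6 * X + C c ^ 5 * X ^ 2 + C c ^ 4 * X ^ 3 + C c ^ 3 * X ^ 4 +
        C c ^ 2 * X ^ 5 + C c * X ^ 6) = C c * (X ^ 7 - 1) := by
  have h7' : (C c : ℂ[X]) ^ 7 = 1 := by rw [← map_pow, h7, map_one]
  linear_combination (-(X : ℂ[X])) * h7'

/-- The projector polynomial takes the value `7` at `c` (`c⁷ = 1`). [folklore] -/
theorem eval_projPoly {c : ℂ} (h7 : c ^ 7 = 1) :
    (1 + C c ^ 6 * X + C c ^ 5 * X ^ 2 + C c ^ 4 * X ^ 3 + C c ^ 3 * X ^ 4 + C c ^ 2 * X ^ 5 +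
        C c * X ^ 6 : ℂ[X]).eval c = 7 := by
  simp only [eval_add, eval_mul, eval_one, eval_pow, eval_C, eval_X]
  linear_combination (6 : ℂ) * h7

/-- `Φ₇² = 7 Φ₇ + (X⁷ - 1)(X⁵ + 2X⁴ + 3X³ + 4X² + 5X + 6)`. [folklore] -/
theorem cyclotomic₇_sq :
    ((1 + X + X ^ 2 + X ^ 3 + X ^ 4 + X ^ 5 + X ^ 6 : ℂ[X])) ^ 2 =
      7 * (1 + X + X ^ 2 + X ^ 3 + X ^ 4 + X ^ 5 + X ^ 6) +
        (X ^ 7 - 1) * (X ^ 5 + 2 * X ^ 4 + 3 * X ^ 3 + 4 * X ^ 2 + 5 * X + 6) := by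
  ring

/-- `aeval T` of the projector polynomial is `1 + c⁶T + ⋯ + cT⁶`. [folklore] -/
theorem aeval_projPoly (T : Module.End ℂ V) (c : ℂ) :
    aeval T (1 + C c ^ 6 * X + C c ^ 5 * X ^ 2 + C c ^ 4 * X ^ 3 + C c ^ 3 * X ^ 4 + C c ^ 2 * X ^ 5 +
        C c * X ^ 6 : ℂ[X]) =
      1 + c ^ 6 • T + c ^ 5 • T ^ 2 + c ^ 4 • T ^ 3 + c ^ 3 • T ^ 4 + c ^ 2 • T ^ 5 + c • T ^ 6 := by
  simp only [map_add, map_mul, map_pow, map_one, aeval_X, aeval_C, Module.algebraMap_end_eq_smul_id,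
    ← Module.End.one_eq_id, _root_.smul_pow, one_pow, smul_mul_assoc, one_mul]

/-- **The projector onto the `c`-eigenspace for `T⁷ = 1`, `c⁷ = 1`.**  `P_c = 7⁻¹ Σ_k c^{7-k} Tᵏ`
satisfies `(T - c) P_c = 7⁻¹ c (T⁷ - 1) = 0` and `P_c x = x` on `Eig(T, c)` (`Σ c^{7-k} cᵏ = 7`).
[folklore] -/
theorem isProj_eigenspace_of_pow_seven (T : Module.End ℂ V) (hT : T ^ 7 = 1) {c : ℂ} (h7 : c ^ 7 = 1) :
    LinearMap.IsProj (T.eigenspace c)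
      ((7 : ℂ)⁻¹ • aeval T (1 + C c ^ 6 * X + C c ^ 5 * X ^ 2 + C c ^ 4 * X ^ 3 + C c ^ 3 * X ^ 4 +
        C c ^ 2 * X ^ 5 + C c * X ^ 6 : ℂ[X])) := by
  have hkill : (T - c • 1) * aeval T (1 + C c ^ 6 * X + C c ^ 5 * X ^ 2 + C c ^ 4 * X ^ 3 +
      C c ^ 3 * X ^ 4 + C c ^ 2 * X ^ 5 + C c * X ^ 6 : ℂ[X]) = 0 := by
    have h := congrArg (aeval T) (X_sub_C_mul_projPoly h7)
    rw [map_mul, map_mul, map_sub, map_sub, map_pow, aeval_X, aeval_C, map_one, hT, sub_self,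
      mul_zero, Module.algebraMap_end_eq_smul_id, ← Module.End.one_eq_id] at h
    exact h
  constructor
  · intro x
    rw [Module.End.mem_eigenspace_iff, LinearMap.smul_apply, map_smul]
    have hx := LinearMap.congr_fun hkill x
    rw [Module.End.mul_apply, LinearMap.sub_apply, LinearMap.smul_apply, Module.End.one_apply,
      LinearMap.zero_apply, sub_eq_zero] at hx
    rw [hx, smul_comm]
  · intro x hx
    rw [Module.End.mem_eigenspace_iff] at hx
    rw [LinearMap.smul_apply, Module.End.aeval_apply_of_mem_apply_eq_smul hx, eval_projPoly h7,
      smul_smul, inv_mul_cancel₀ (by norm_num), one_smul]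

/-- **`7 · dim Eig(T, c) = dim V + c⁶ tr T + c⁵ tr T² + c⁴ tr T³ + c³ tr T⁴ + c² tr T⁵ + c tr T⁶`**
(`T⁷ = 1`, `c⁷ = 1`; the trace of the projector `P_c`). [folklore] -/
theorem seven_mul_finrank_eigenspace [FiniteDimensional ℂ V] (T : Module.End ℂ V) (hT : T ^ 7 = 1)
    {c : ℂ} (h7 : c ^ 7 = 1) :
    (7 : ℂ) * Module.finrank ℂ (T.eigenspace c) =
      Module.finrank ℂ V + c ^ 6 * LinearMap.trace ℂ V T + c ^ 5 * LinearMap.trace ℂ V (T ^ 2) +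
        c ^ 4 * LinearMap.trace ℂ V (T ^ 3) + c ^ 3 * LinearMap.trace ℂ V (T ^ 4) +
        c ^ 2 * LinearMap.trace ℂ V (T ^ 5) + c * LinearMap.trace ℂ V (T ^ 6) := by
  have h := (isProj_eigenspace_of_pow_seven T hT h7).trace
  rw [map_smul, smul_eq_mul, aeval_projPoly] at h
  rw [← h, ← mul_assoc, mul_inv_cancel₀ (by norm_num), one_mul]
  simp only [map_add, map_smul, LinearMap.trace_one, smul_eq_mul]

/-- **`dim Eig(T, c) = 12`** for `T⁷ = 1` on an `86`-dimensional space with `tr Tʲ = 2`,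
`j = 1, …, 6`, and `c` a primitive seventh root of unity (`Φ₇(c) = 0`): `7·dim = 86 + 2 Σ_{k=1}^{6} c^{7-k}
= 86 - 2 = 84`.  (Chevalley–Weil for a free `ℤ/7`-action on a genus-`43` curve: every non-trivial
character occurs `12 = 2g(C/σ) - 2` times in `H¹`.) [folklore] -/
theorem finrank_eigenspace_eq_twelve [FiniteDimensional ℂ V] (T : Module.End ℂ V) (hT : T ^ 7 = 1)
    (hV : Module.finrank ℂ V = 86) {c : ℂ} (h7 : c ^ 7 = 1)
    (hΦ : 1 + c + c ^ 2 + c ^ 3 + c ^ 4 + c ^ 5 + c ^ 6 = 0)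
    (htr : ∀ j : ℕ, 1 ≤ j → j ≤ 6 → LinearMap.trace ℂ V (T ^ j) = 2) :
    Module.finrank ℂ (T.eigenspace c) = 12 := by
  have h := seven_mul_finrank_eigenspace T hT h7
  have t1 : LinearMap.trace ℂ V T = 2 := by simpa using htr 1 le_rfl (by norm_num)
  rw [hV, t1, htr 2 (by norm_num) (by norm_num), htr 3 (by norm_num) (by norm_num),
    htr 4 (by norm_num) (by norm_num), htr 5 (by norm_num) (by norm_num),
    htr 6 (by norm_num) (by norm_num)] at h
  have h' : (7 : ℂ) * Module.finrank ℂ (T.eigenspace c) = 7 * 12 := by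
    rw [h]; push_cast; linear_combination (2 : ℂ) * hΦ
  exact_mod_cast mul_left_cancel₀ (by norm_num : (7 : ℂ) ≠ 0) h'

/-- An intertwiner `f ∘ T = T' ∘ f` intertwines `p(T)` and `p(T')` for every polynomial `p`.
[folklore] -/
theorem comp_aeval_eq_aeval_comp {T : Module.End ℂ V} {T' : Module.End ℂ W} {f : V →ₗ[ℂ] W}
    (h : f ∘ₗ T = T' ∘ₗ f) (p : ℂ[X]) : f ∘ₗ aeval T p = aeval T' p ∘ₗ f := by
  refine p.induction_on (fun a => ?_) (fun p q hp hq => ?_) (fun n a hna => ?_)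
  · rw [aeval_C, aeval_C, Module.algebraMap_end_eq_smul_id, Module.algebraMap_end_eq_smul_id,
      LinearMap.comp_smul, LinearMap.smul_comp, LinearMap.comp_id, LinearMap.id_comp]
  · rw [map_add, map_add, LinearMap.comp_add, LinearMap.add_comp, hp, hq]
  · rw [pow_succ, ← mul_assoc, map_mul (aeval T) (C a * X ^ n) X, map_mul (aeval T') (C a * X ^ n) X,
      aeval_X, aeval_X, Module.End.mul_eq_comp, Module.End.mul_eq_comp, ← LinearMap.comp_assoc, hna,
      LinearMap.comp_assoc, h, ← LinearMap.comp_assoc]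

/-- **Multiplicities are unchanged under an equivariant quotient by `im Φ₇(T)`.**  Let `T⁷ = 1` on
`V`, `T'⁷ = 1` on `W` (finite-dimensional), `f : V ↠ W` surjective with `f ∘ T = T' ∘ f`,
`im Φ₇(T) ⊆ ker f` and `dim W = dim ker Φ₇(T)`.  Then for a PRIMITIVE seventh root `c`
(`c⁷ = 1`, `Φ₇(c) = 0`), `dim Eig(T', c) = dim Eig(T, c)`.  Proof: `ker f = im Φ₇(T)` (dimensions);
`Eig(T', c) = f(Eig(T, c))` (`⊇` by equivariance, `⊆` by the equivariant projector `P_c`); and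
`f` is injective on `Eig(T, c)`, since `x = Φ₇(T) z` with `Φ₇(T) x = Φ₇(c) x = 0` gives
`0 = Φ₇(T)² z = 7 Φ₇(T) z = 7x`. [folklore] -/
theorem finrank_eigenspace_eq_of_surjective {V W : Type*} [AddCommGroup V] [Module ℂ V]
    [AddCommGroup W] [Module ℂ W] [FiniteDimensional ℂ V] [FiniteDimensional ℂ W]
    (T : Module.End ℂ V) (T' : Module.End ℂ W) (f : V →ₗ[ℂ] W) (hf : Function.Surjective f)
    (hcomm : f ∘ₗ T = T' ∘ₗ f) (hT : T ^ 7 = 1) (hT' : T' ^ 7 = 1)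
    (hW : Module.finrank ℂ W =
      Module.finrank ℂ (LinearMap.ker (aeval T (1 + X + X ^ 2 + X ^ 3 + X ^ 4 + X ^ 5 + X ^ 6 : ℂ[X]))))
    (hker : LinearMap.range (aeval T (1 + X + X ^ 2 + X ^ 3 + X ^ 4 + X ^ 5 + X ^ 6 : ℂ[X])) ≤
      LinearMap.ker f)
    {c : ℂ} (h7 : c ^ 7 = 1) (hΦ : 1 + c + c ^ 2 + c ^ 3 + c ^ 4 + c ^ 5 + c ^ 6 = 0) :
    Module.finrank ℂ (T'.eigenspace c) = Module.finrank ℂ (T.eigenspace c) := by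
  set Φ : ℂ[X] := 1 + X + X ^ 2 + X ^ 3 + X ^ 4 + X ^ 5 + X ^ 6 with hΦdef
  set qc : ℂ[X] := 1 + C c ^ 6 * X + C c ^ 5 * X ^ 2 + C c ^ 4 * X ^ 3 + C c ^ 3 * X ^ 4 +
    C c ^ 2 * X ^ 5 + C c * X ^ 6 with hqc
  -- `ker f = im Φ₇(T)`
  have hkerEq : LinearMap.range (aeval T Φ) = LinearMap.ker f := by
    refine Submodule.eq_of_le_of_finrank_le hker ?_
    have h1 := LinearMap.finrank_range_add_finrank_ker f
    have h2 := LinearMap.finrank_range_add_finrank_ker (aeval T Φ)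
    rw [LinearMap.range_eq_top.mpr hf, finrank_top] at h1
    omega
  -- `Eig(T', c) = f (Eig(T, c))`
  have hP := isProj_eigenspace_of_pow_seven T hT h7
  have hP' := isProj_eigenspace_of_pow_seven T' hT' h7
  have hcommq := comp_aeval_eq_aeval_comp hcomm qc
  have hEq : T'.eigenspace c = (T.eigenspace c).map f := by
    apply le_antisymm
    · intro y hy
      obtain ⟨x, rfl⟩ := hf y
      refine ⟨((7 : ℂ)⁻¹ • aeval T qc) x, hP.map_mem x, ?_⟩
      rw [LinearMap.smul_apply, map_smul, ← LinearMap.comp_apply, hcommq, LinearMap.comp_apply,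
        ← LinearMap.smul_apply]
      exact hP'.map_id _ hy
    · rintro _ ⟨x, hx, rfl⟩
      rw [SetLike.mem_coe, Module.End.mem_eigenspace_iff] at hx
      rw [Module.End.mem_eigenspace_iff, ← LinearMap.comp_apply, ← hcomm, LinearMap.comp_apply, hx,
        map_smul]
  -- `f` is injective on `Eig(T, c)`
  have hinj : Function.Injective (f.domRestrict (T.eigenspace c)) := by
    rw [injective_iff_map_eq_zero]
    rintro ⟨x, hx⟩ h0
    rw [LinearMap.domRestrict_apply] at h0
    have hxker : x ∈ LinearMap.ker f := h0
    rw [← hkerEq] at hxker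
    obtain ⟨z, rfl⟩ := hxker
    rw [Module.End.mem_eigenspace_iff] at hx
    -- `Φ₇(T) (Φ₇(T) z) = Φ₇(c) • Φ₇(T) z = 0` and `= 7 • Φ₇(T) z`
    have h1 : aeval T Φ (aeval T Φ z) = 0 := by
      rw [Module.End.aeval_apply_of_mem_apply_eq_smul hx]
      simp only [hΦdef, eval_add, eval_one, eval_pow, eval_X, hΦ, zero_smul]
    have h2 : aeval T Φ (aeval T Φ z) = (7 : ℂ) • aeval T Φ z := by
      rw [← Module.End.mul_apply, ← map_mul, ← sq, hΦdef, cyclotomic₇_sq, map_add, map_mul, map_mul,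
        map_sub, map_pow, aeval_X, map_one, hT, sub_self, zero_mul, add_zero, Module.End.mul_apply,
        map_ofNat, Module.End.ofNat_apply, ← Nat.cast_smul_eq_nsmul ℂ, Nat.cast_ofNat]
    rw [h2] at h1
    have hz : aeval T Φ z = 0 := by
      rcases smul_eq_zero.mp h1 with h | h
      · norm_num at h
      · exact h
    exact Subtype.ext hz
  rw [hEq, ← LinearMap.range_domRestrict, LinearMap.finrank_range_of_inj hinj]

end LinearAlgebra

end Summit.HodgeConjecture.HodgeConjecture.Theorems.WeilTwelvefoldsSqrtMinus7.IsotypicUnimodularSaturation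

end
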